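import Mathlib
import Literature.Analysis.FluidPDE.HardSphereCollisionEnumeration
import Literature.Analysis.FluidPDE.HardSphereRegularGeometry
import HarnessLib

/-!
# `OneFlightGossipEngine.OneFlightLayeredChaos` — the window event `W` is measurable on the good set
(crux stmt-AtomisticToContinuum-14535, helper for every line)

The crux's event `W = {z | n + 1 ≤ ncard (collisionTimesOf G ε (Φ.flow · z) i ∩ Ioc 0 w)}` ("particle `i` has at
least `n + 1` collisions in the window `(0, w]`") is built from the flow at a continuum of times; the structure
`HardSphereFlow` only provides measurability of each time-`t` map. On the good set this suffices: along a good
orbit positions are continuous and inter-particle distances are `≥ ε`, so "a collision of `k` in `[a, b]`" is the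
`G_δ`-type condition "for every `n` some clamped rational time has an inter-particle distance `< ε + 1/(n+1)`", and
"at least `m` collisions in `(0, w]`" is a countable union over rational interval systems. No dynamics beyond the
structure fields of `HardSphereFlow` (torus geometry, any dimension, any `ε`); no new definitions (the pair
distance `‖sepVec (x_k(t)) (x_j(t))‖` and the clamp `max a (min b r)` are written out).
-/

open MeasureTheory Set Filter Topology
open Literature.Analysis.FluidPDE

namespace Summit.AtomisticToContinuum.HydrodynamicLimit.Theorems

variable {d : Type*} [Fintype d] {N : ℕ} {ε : ℝ}

/-- For fixed time the pair (minimal-image) distance `‖sepVec (x_k(t)) (x_j(t))‖` is measurable in the initial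
datum. [folklore] -/
theorem measurable_pairDist_flow (Φ : HardSphereFlow (Torus.geometry d) ε N) (k j : Fin N) (t : ℝ) :
    Measurable fun z : Config N d (UnitAddTorus d) =>
      ‖(Torus.geometry d).sepVec ((Φ.flow t z k).1) ((Φ.flow t z j).1)‖ := by
  have hk : Measurable fun z : Config N d (UnitAddTorus d) => (Φ.flow t z k).1 :=
    ((measurable_pi_apply k).comp (Φ.measurable_flow t)).fst
  have hj : Measurable fun z : Config N d (UnitAddTorus d) => (Φ.flow t z j).1 :=
    ((measurable_pi_apply j).comp (Φ.measurable_flow t)).fst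
  exact (Torus.measurable_geometry_sepVec.comp (hk.prodMk hj)).norm

/-- Along a good orbit the pair distance is continuous in time. [folklore] -/
theorem continuous_pairDist_flow (Φ : HardSphereFlow (Torus.geometry d) ε N) (k j : Fin N)
    {z : Config N d (UnitAddTorus d)} (hz : z ∈ Φ.good) :
    Continuous fun t : ℝ => ‖(Torus.geometry d).sepVec ((Φ.flow t z k).1) ((Φ.flow t z j).1)‖ := by
  have hk := (Φ.isTrajectory z hz).pos_continuous k
  have hj := (Φ.isTrajectory z hz).pos_continuous j
  have h := Torus.continuous_euclidDist.comp (hk.prodMk hj)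
  have hfun : (fun t : ℝ => ‖(Torus.geometry d).sepVec ((Φ.flow t z k).1) ((Φ.flow t z j).1)‖) =
      (fun p : UnitAddTorus d × UnitAddTorus d => Torus.euclidDist p.1 p.2) ∘
        fun t => ((Φ.flow t z k).1, (Φ.flow t z j).1) := rfl
  rw [hfun]
  exact h

/-- Along a good orbit distinct particles stay at distance `≥ ε`. [folklore] -/
theorem le_pairDist_flow (Φ : HardSphereFlow (Torus.geometry d) ε N) {k j : Fin N} (hkj : k ≠ j)
    {z : Config N d (UnitAddTorus d)} (hz : z ∈ Φ.good) (t : ℝ) :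
    ε ≤ ‖(Torus.geometry d).sepVec ((Φ.flow t z k).1) ((Φ.flow t z j).1)‖ :=
  mem_hardSphereDomain.1 ((Φ.isTrajectory z hz).mem t) k j hkj

/-- Participation of `k` at time `t` along the orbit of a GOOD datum, in terms of pair distances. [folklore] -/
theorem participates_flow_iff (Φ : HardSphereFlow (Torus.geometry d) ε N) (k : Fin N)
    {z : Config N d (UnitAddTorus d)} (hz : z ∈ Φ.good) (t : ℝ) :
    Participates (Torus.geometry d) ε (Φ.flow t z) k ↔
      ∃ j, j ≠ k ∧ ‖(Torus.geometry d).sepVec ((Φ.flow t z k).1) ((Φ.flow t z j).1)‖ = ε := by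
  have hdom : Φ.flow t z ∈ hardSphereDomain (Torus.geometry d) N ε := (Φ.isTrajectory z hz).mem t
  constructor
  · rintro ⟨j, h | h⟩
    · have h' := (mem_contactPairs_iff_of_mem hdom).1 h
      exact ⟨j, fun hjk => h'.1 hjk.symm, h'.2⟩
    · have h' := (mem_contactPairs_iff_of_mem hdom).1 h
      refine ⟨j, h'.1, ?_⟩
      -- symmetry of the minimal-image distance
      have : ‖(Torus.geometry d).sepVec ((Φ.flow t z k).1) ((Φ.flow t z j).1)‖ =
          ‖(Torus.geometry d).sepVec ((Φ.flow t z j).1) ((Φ.flow t z k).1)‖ := Torus.euclidDist_comm _ _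
      rw [this]; exact h'.2
  · rintro ⟨j, hjk, h⟩
    exact ⟨j, Or.inl ((mem_contactPairs_iff_of_mem hdom).2 ⟨fun hkj => hjk hkj.symm, h⟩)⟩

/-- For fixed time, the participation event is measurable (no good-set restriction needed). [folklore] -/
theorem measurableSet_participates_flow (Φ : HardSphereFlow (Torus.geometry d) ε N) (k : Fin N) (t : ℝ) :
    MeasurableSet {z : Config N d (UnitAddTorus d) | Participates (Torus.geometry d) ε (Φ.flow t z) k} := by
  have hc : ∀ i j : Fin N, MeasurableSet (contactSet (Torus.geometry d) N ε i j) := fun i j =>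
    measurableSet_contactSet _ Torus.measurable_geometry_sepVec N ε i j
  have : {z : Config N d (UnitAddTorus d) | Participates (Torus.geometry d) ε (Φ.flow t z) k} =
      ⋃ j : Fin N, ((if k ≠ j then (Φ.flow t) ⁻¹' contactSet (Torus.geometry d) N ε k j else ∅) ∪
        (if j ≠ k then (Φ.flow t) ⁻¹' contactSet (Torus.geometry d) N ε j k else ∅)) := by
    ext z
    simp only [mem_setOf_eq, mem_iUnion, mem_union]
    constructor
    · rintro ⟨j, h | h⟩
      · have h' := mem_contactPairs.1 h
        exact ⟨j, Or.inl (by rw [if_pos h'.1]; exact h'.2)⟩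
      · have h' := mem_contactPairs.1 h
        exact ⟨j, Or.inr (by rw [if_pos h'.1]; exact h'.2)⟩
    · rintro ⟨j, h | h⟩
      · by_cases hkj : k ≠ j
        · rw [if_pos hkj] at h; exact ⟨j, Or.inl (mem_contactPairs.2 ⟨hkj, h⟩)⟩
        · rw [if_neg hkj] at h; exact absurd h (notMem_empty _)
      · by_cases hjk : j ≠ k
        · rw [if_pos hjk] at h; exact ⟨j, Or.inr (mem_contactPairs.2 ⟨hjk, h⟩)⟩
        · rw [if_neg hjk] at h; exact absurd h (notMem_empty _)
  rw [this]
  refine MeasurableSet.iUnion fun j => MeasurableSet.union ?_ ?_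
  · split_ifs
    · exact Φ.measurable_flow t (hc k j)
    · exact MeasurableSet.empty
  · split_ifs
    · exact Φ.measurable_flow t (hc j k)
    · exact MeasurableSet.empty

omit [Fintype d] in
/-- The clamp `max a (min b r)` lands in `[a, b]` (for `a ≤ b`). [folklore] -/
theorem clamp_mem_Icc {a b : ℝ} (hab : a ≤ b) (r : ℝ) : max a (min b r) ∈ Icc a b :=
  ⟨le_max_left _ _, max_le hab (min_le_left _ _)⟩

omit [Fintype d] in
/-- The clamp is non-expansive towards points of `[a, b]`. [folklore] -/
theorem abs_clamp_sub_le {a b r t : ℝ} (ht : t ∈ Icc a b) : |max a (min b r) - t| ≤ |r - t| := by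
  obtain ⟨hat, htb⟩ := ht
  rcases le_total r a with hra | har
  · rw [min_eq_right (hra.trans (hat.trans htb)), max_eq_left hra,
      abs_of_nonpos (by linarith), abs_of_nonpos (by linarith)]
    linarith
  · rcases le_total r b with hrb | hbr
    · rw [min_eq_right hrb, max_eq_right har]
    · rw [min_eq_left hbr, max_eq_right (hat.trans htb),
        abs_of_nonneg (by linarith), abs_of_nonneg (by linarith)]
      linarith

/-- **A collision of `k` in `[a, b]`, along a good orbit, is a countable condition**: it happens iff for some
`j ≠ k` and every `n` some clamped rational time `max a (min b q)` has pair distance `< ε + 1/(n+1)` (continuity of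
positions + distances `≥ ε` + compactness of `[a, b]`). [folklore] -/
theorem exists_participates_Icc_iff (Φ : HardSphereFlow (Torus.geometry d) ε N) (k : Fin N)
    {z : Config N d (UnitAddTorus d)} (hz : z ∈ Φ.good) {a b : ℝ} (hab : a ≤ b) :
    (∃ t ∈ Icc a b, Participates (Torus.geometry d) ε (Φ.flow t z) k) ↔
      ∃ j, j ≠ k ∧ ∀ n : ℕ, ∃ q : ℚ,
        ‖(Torus.geometry d).sepVec ((Φ.flow (max a (min b (q : ℝ))) z k).1)
            ((Φ.flow (max a (min b (q : ℝ))) z j).1)‖ < ε + 1 / ((n : ℝ) + 1) := by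
  constructor
  · rintro ⟨t, ht, hpart⟩
    obtain ⟨j, hjk, hdist⟩ := (participates_flow_iff Φ k hz t).1 hpart
    refine ⟨j, hjk, fun n => ?_⟩
    set D : ℝ → ℝ := fun s => ‖(Torus.geometry d).sepVec ((Φ.flow s z k).1) ((Φ.flow s z j).1)‖ with hD
    have hcont : Continuous D := continuous_pairDist_flow Φ k j hz
    have hn : (0 : ℝ) < 1 / ((n : ℝ) + 1) := by positivity
    -- continuity at t: a neighbourhood on which D < ε + 1/(n+1)
    have hev : ∀ᶠ s in 𝓝 t, D s < ε + 1 / ((n : ℝ) + 1) := by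
      have : D t < ε + 1 / ((n : ℝ) + 1) := by rw [hD]; simp only; rw [hdist]; linarith
      exact (hcont.tendsto t).eventually (gt_mem_nhds this)
    obtain ⟨δ, hδ, hball⟩ := Metric.eventually_nhds_iff.1 hev
    obtain ⟨q, hq1, hq2⟩ := exists_rat_btwn (show t - δ < t + δ by linarith)
    refine ⟨q, ?_⟩
    have hclose : dist (max a (min b (q : ℝ))) t < δ := by
      rw [Real.dist_eq]
      refine lt_of_le_of_lt (abs_clamp_sub_le ht) ?_
      rw [abs_lt]; constructor <;> linarith
    exact hball hclose
  · rintro ⟨j, hjk, hforall⟩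
    set D : ℝ → ℝ := fun s => ‖(Torus.geometry d).sepVec ((Φ.flow s z k).1) ((Φ.flow s z j).1)‖ with hD
    have hcont : Continuous D := continuous_pairDist_flow Φ k j hz
    -- minimum of D on the compact interval
    obtain ⟨t₀, ht₀, hmin⟩ :=
      (isCompact_Icc (a := a) (b := b)).exists_isMinOn (nonempty_Icc.2 hab) hcont.continuousOn
    have hle : D t₀ ≤ ε := by
      refine le_of_forall_pos_lt_add fun η hη => ?_
      obtain ⟨n, hn⟩ := exists_nat_one_div_lt hη
      obtain ⟨q, hq⟩ := hforall n
      have hmem : max a (min b (q : ℝ)) ∈ Icc a b := clamp_mem_Icc hab q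
      calc D t₀ ≤ D (max a (min b (q : ℝ))) := hmin hmem
        _ < ε + 1 / ((n : ℝ) + 1) := hq
        _ < ε + η := by linarith
    have hge : ε ≤ D t₀ := le_pairDist_flow Φ (fun h => hjk h.symm) hz t₀
    exact ⟨t₀, ht₀, (participates_flow_iff Φ k hz t₀).2 ⟨j, hjk, le_antisymm hle hge⟩⟩

/-- **The event "`k` collides in `[a, b]`" is measurable on the good set.** [folklore] -/
theorem measurableSet_good_inter_exists_participates_Icc (Φ : HardSphereFlow (Torus.geometry d) ε N)
    (k : Fin N) (a b : ℝ) :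
    MeasurableSet (Φ.good ∩ {z : Config N d (UnitAddTorus d) |
      ∃ t ∈ Icc a b, Participates (Torus.geometry d) ε (Φ.flow t z) k}) := by
  by_cases hab : a ≤ b
  · have hrepr : Φ.good ∩ {z : Config N d (UnitAddTorus d) |
          ∃ t ∈ Icc a b, Participates (Torus.geometry d) ε (Φ.flow t z) k} =
        Φ.good ∩ ⋃ j : Fin N, ⋂ n : ℕ, ⋃ q : ℚ,
          (if j ≠ k then {z | ‖(Torus.geometry d).sepVec ((Φ.flow (max a (min b (q : ℝ))) z k).1)
              ((Φ.flow (max a (min b (q : ℝ))) z j).1)‖ < ε + 1 / ((n : ℝ) + 1)} else ∅) := by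
      ext z
      simp only [mem_inter_iff, mem_setOf_eq, mem_iUnion, mem_iInter]
      constructor
      · rintro ⟨hz, hex⟩
        obtain ⟨j, hjk, h⟩ := (exists_participates_Icc_iff Φ k hz hab).1 hex
        refine ⟨hz, j, fun n => ?_⟩
        obtain ⟨q, hq⟩ := h n
        exact ⟨q, by rw [if_pos hjk]; exact hq⟩
      · rintro ⟨hz, j, h⟩
        refine ⟨hz, (exists_participates_Icc_iff Φ k hz hab).2 ⟨j, ?_, fun n => ?_⟩⟩
        · intro hjk
          obtain ⟨q, hq⟩ := h 0
          rw [if_neg (not_not.2 hjk)] at hq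
          exact hq
        · obtain ⟨q, hq⟩ := h n
          by_cases hjk : j ≠ k
          · rw [if_pos hjk] at hq; exact ⟨q, hq⟩
          · rw [if_neg hjk] at hq; exact absurd hq (notMem_empty _)
    rw [hrepr]
    refine Φ.measurableSet_good.inter (MeasurableSet.iUnion fun j => MeasurableSet.iInter fun n =>
      MeasurableSet.iUnion fun q => ?_)
    split_ifs
    · exact measurableSet_lt (measurable_pairDist_flow Φ k j _) measurable_const
    · exact MeasurableSet.empty
  · have : {z : Config N d (UnitAddTorus d) |
        ∃ t ∈ Icc a b, Participates (Torus.geometry d) ε (Φ.flow t z) k} = ∅ := by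
      ext z
      simp only [mem_setOf_eq, mem_empty_iff_false, iff_false, not_exists, not_and]
      intro t ht
      exact absurd (ht.1.trans ht.2) hab
    rw [this, inter_empty]
    exact MeasurableSet.empty

/-- **"At least `m` collisions of `k` in `(0, w]`", along a good orbit, is a countable condition**: it holds iff
there are rationals `0 < a₁ ≤ b₁ < a₂ ≤ b₂ < ⋯ < a_m` with a collision of `k` in each `[a_j, min(b_j, w)]`.
[folklore] -/
theorem le_ncard_collisionTimesOf_iff (Φ : HardSphereFlow (Torus.geometry d) ε N) (k : Fin N)
    {z : Config N d (UnitAddTorus d)} (hz : z ∈ Φ.good) (m : ℕ) (w : ℝ) :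
    m ≤ (collisionTimesOf (Torus.geometry d) ε (fun t => Φ.flow t z) k ∩ Ioc 0 w).ncard ↔
      ∃ ab : Fin m → ℚ × ℚ,
        (∀ j, (0 : ℝ) < (ab j).1 ∧ ∃ t ∈ Icc ((ab j).1 : ℝ) (min ((ab j).2 : ℝ) w),
            Participates (Torus.geometry d) ε (Φ.flow t z) k) ∧
        (∀ j j' : Fin m, j.1 + 1 = j'.1 → ((ab j).2 : ℝ) < (ab j').1) := by
  have hfin : (collisionTimesOf (Torus.geometry d) ε (fun t => Φ.flow t z) k ∩ Ioc 0 w).Finite :=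
    (Φ.isTrajectory z hz).finite_collisionTimesOf_inter_Ioc k 0 w
  constructor
  · intro hm
    -- enumerate the collision times increasingly
    set F := hfin.toFinset with hF
    have hcard : m ≤ F.card := by rwa [hF, ← Set.ncard_eq_toFinset_card _ hfin]
    set e := F.orderEmbOfFin rfl with he
    let t : Fin m → ℝ := fun j => e ⟨j.1, lt_of_lt_of_le j.2 hcard⟩
    have ht_mem : ∀ j, t j ∈ collisionTimesOf (Torus.geometry d) ε (fun t => Φ.flow t z) k ∩ Ioc 0 w :=
      fun j => (Set.Finite.mem_toFinset hfin).1 (F.orderEmbOfFin_mem rfl _)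
    have ht_mono : ∀ j j' : Fin m, j.1 < j'.1 → t j < t j' := fun j j' h =>
      e.strictMono (show (⟨j.1, _⟩ : Fin F.card) < ⟨j'.1, _⟩ from h)
    -- the upper rationals b_j ∈ (t_j, next)
    let u : Fin m → ℝ := fun j => if h : j.1 + 1 < m then t ⟨j.1 + 1, h⟩ else t j + 1
    have htu : ∀ j, t j < u j := by
      intro j
      by_cases h : j.1 + 1 < m
      · simp only [u, dif_pos h]; exact ht_mono _ _ (by simp)
      · simp only [u, dif_neg h]; linarith
    choose b hb using fun j => exists_rat_btwn (htu j)
    -- the lower rationals a_j ∈ (previous b, t_j)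
    let l : Fin m → ℝ := fun j => if h : 0 < j.1 then (b ⟨j.1 - 1, by omega⟩ : ℝ) else 0
    have hlt : ∀ j, l j < t j := by
      intro j
      by_cases h : 0 < j.1
      · simp only [l, dif_pos h]
        have h1 : (⟨j.1 - 1, by omega⟩ : Fin m).1 + 1 < m := by simp; omega
        have := (hb ⟨j.1 - 1, by omega⟩).2
        simp only [u, dif_pos h1] at this
        have heq : (⟨(⟨j.1 - 1, by omega⟩ : Fin m).1 + 1, h1⟩ : Fin m) = j := by
          ext; simp; omega
        rw [heq] at this
        exact this
      · simp only [l, dif_neg h]; exact (ht_mem j).2.1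
    choose a ha using fun j => exists_rat_btwn (hlt j)
    have hl0 : ∀ j, 0 ≤ l j := by
      intro j
      by_cases h : 0 < j.1
      · simp only [l, dif_pos h]
        exact ((ht_mem _).2.1.trans (hb _).1).le
      · simp only [l, dif_neg h]; exact le_rfl
    refine ⟨fun j => (a j, b j), fun j => ⟨(hl0 j).trans_lt (ha j).1, t j, ⟨(ha j).2.le, ?_⟩, (ht_mem j).1⟩,
      fun j j' hjj' => ?_⟩
    · exact le_min (hb j).1.le (ht_mem j).2.2
    · -- b_j < a_{j'} for consecutive indices
      have hpos : 0 < j'.1 := by omega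
      have := (ha j').1
      simp only [l, dif_pos hpos] at this
      have heq : (⟨j'.1 - 1, by omega⟩ : Fin m) = j := by ext; simp; omega
      rw [heq] at this
      exact this
  · rintro ⟨ab, hcoll, hsucc⟩
    choose s hs using fun j => (hcoll j).2
    -- s is strictly increasing along successors, hence injective
    have hsucc' : ∀ j j' : Fin m, j.1 + 1 = j'.1 → s j < s j' := by
      intro j j' h
      calc s j ≤ min ((ab j).2 : ℝ) w := (hs j).1.2
        _ ≤ (ab j).2 := min_le_left _ _
        _ < (ab j').1 := hsucc j j' h
        _ ≤ s j' := (hs j').1.1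
    have hlt : ∀ (p : ℕ) (j j' : Fin m), j.1 + p + 1 = j'.1 → s j < s j' := by
      intro p
      induction p with
      | zero => intro j j' h; exact hsucc' j j' (by omega)
      | succ p ih =>
        intro j j' h
        have hmid : j.1 + p + 1 < m := by omega
        exact (ih j ⟨j.1 + p + 1, hmid⟩ (by simp)).trans (hsucc' ⟨j.1 + p + 1, hmid⟩ j' (by simp; omega))
    have hinj : Function.Injective s := by
      intro j j' h
      rcases lt_trichotomy j.1 j'.1 with hjj | hjj | hjj
      · exact absurd h (ne_of_lt (hlt (j'.1 - j.1 - 1) j j' (by omega)))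
      · exact Fin.ext hjj
      · exact absurd h (ne_of_gt (hlt (j.1 - j'.1 - 1) j' j (by omega)))
    have hsub : Set.range s ⊆ collisionTimesOf (Torus.geometry d) ε (fun t => Φ.flow t z) k ∩ Ioc 0 w := by
      rintro _ ⟨j, rfl⟩
      refine ⟨(hs j).2, (hcoll j).1.trans_le (hs j).1.1, ?_⟩
      exact (hs j).1.2.trans (min_le_right _ _)
    calc m = (Set.range s).ncard := by
          rw [← Set.image_univ, Set.ncard_image_of_injective _ hinj, Set.ncard_univ, Nat.card_fin]
      _ ≤ _ := Set.ncard_le_ncard hsub hfin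

/-- **The window event is measurable on the good set**: for every particle `k`, count `m` and window end `w`,
`Φ.good ∩ {z | m ≤ ncard (collisionTimesOf G ε (Φ.flow · z) k ∩ Ioc 0 w)}` is measurable — in particular the crux's
`W` (with `m = n + 1`, `k = i`, `w = τ (N+1)^{-1/3}`) is measurable up to the null set `Φ.goodᶜ`. [folklore] -/
theorem measurableSet_good_inter_le_ncard_collisionTimesOf : ∀ {d : Type*} [Fintype d] {N : ℕ} {ε : ℝ} (Φ : Literature.Analysis.FluidPDE.HardSphereFlow (Literature.Analysis.FluidPDE.Torus.geometry d) ε N) (k : Fin N) (m : ℕ) (w : ℝ), MeasurableSet (Φ.good ∩ {z : Literature.Analysis.FluidPDE.Config N d (UnitAddTorus d) | m ≤ (Literature.Analysis.FluidPDE.collisionTimesOf (Literature.Analysis.FluidPDE.Torus.geometry d) ε (fun t => Φ.flow t z) k ∩ Set.Ioc 0 w).ncard}) := by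
  intro d _ N ε Φ k m w
  classical
  -- the admissible rational interval systems (a condition not involving `z`)
  let Adm : (Fin m → ℚ × ℚ) → Prop := fun ab =>
    (∀ j, (0 : ℝ) < (ab j).1) ∧ (∀ j j' : Fin m, j.1 + 1 = j'.1 → ((ab j).2 : ℝ) < (ab j').1)
  let E : ℚ × ℚ → Set (Config N d (UnitAddTorus d)) := fun q =>
    Φ.good ∩ {z | ∃ t ∈ Icc (q.1 : ℝ) (min (q.2 : ℝ) w), Participates (Torus.geometry d) ε (Φ.flow t z) k}
  have hE : ∀ q, MeasurableSet (E q) := fun q =>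
    measurableSet_good_inter_exists_participates_Icc Φ k _ _
  have hrepr : Φ.good ∩ {z : Config N d (UnitAddTorus d) |
        m ≤ (collisionTimesOf (Torus.geometry d) ε (fun t => Φ.flow t z) k ∩ Ioc 0 w).ncard} =
      ⋃ ab : Fin m → ℚ × ℚ, if Adm ab then Φ.good ∩ ⋂ j, E (ab j) else ∅ := by
    ext z
    simp only [mem_inter_iff, mem_setOf_eq, mem_iUnion]
    constructor
    · rintro ⟨hz, hm⟩
      obtain ⟨ab, hcoll, hsucc⟩ := (le_ncard_collisionTimesOf_iff Φ k hz m w).1 hm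
      refine ⟨ab, ?_⟩
      rw [if_pos ⟨fun j => (hcoll j).1, hsucc⟩]
      exact ⟨hz, mem_iInter.2 fun j => ⟨hz, (hcoll j).2⟩⟩
    · rintro ⟨ab, h⟩
      by_cases hadm : Adm ab
      · rw [if_pos hadm] at h
        obtain ⟨hz, hall⟩ := h
        refine ⟨hz, (le_ncard_collisionTimesOf_iff Φ k hz m w).2 ⟨ab, fun j => ⟨hadm.1 j, ?_⟩, hadm.2⟩⟩
        exact ((mem_iInter.1 hall) j).2
      · rw [if_neg hadm] at h
        exact absurd h (notMem_empty _)
  rw [hrepr]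
  refine MeasurableSet.iUnion fun ab => ?_
  split_ifs
  · exact Φ.measurableSet_good.inter (MeasurableSet.iInter fun j => hE _)
  · exact MeasurableSet.empty

end Summit.AtomisticToContinuum.HydrodynamicLimit.Theorems
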